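import Mathlib

/-!
# A singular `2 × 2` block of linear forms has a controlling row or column

Route `ValiantsHypothesis/BorderApolarity`, crux `ToricWitnessObstructionQP`
(stmt-ValiantsHypothesis-14753), line `Sketch`, lead c5 — sixth helper for the regime analysis of
torus leading forms of `per₃` below Grenet's size `7` (crux work note `regimes.md`, §3 step (i),
corank-`2` branch): if `N = [[p, q], [r, t]]` is a matrix of linear forms with `det N = pt - qr = 0`
identically, then unique factorisation of the linear form `p` gives `q = αp, t = αr`, or
`r = βp, t = βq`, or `p = 0 ∧ (q = 0 ∨ r = 0)`; in every case two of the four entries (a column or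
a row) control all of them:

* `exists_two_entries_control`: there are two positions whose entries' common zeros are common
  zeros of all four entries.

(Consequently every `3 × 3` principal minor through the block vanishes on a linear subspace of
codimension `≤ 2`, which is how the corank-`2` branch of the jet-regime theorem reaches
`initialDegeneration_of_vanishing` and `noSevenPlane_perPoly_three`.)
-/

open MvPolynomial

-- the mandated summit-side namespace repeats a component by design (single-problem summit)
set_option linter.dupNamespace false

namespace Summit.ValiantsHypothesis.ValiantsHypothesis.Theorems.BorderApolarityToricWitnessObstructionQP

noncomputable section

namespace SingularBlock

variable {K : Type*} [Field K] {σ : Type*}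

/-- A polynomial of total degree `0` with non-zero constant coefficient is a unit. -/
theorem isUnit_of_totalDegree_eq_zero {u : MvPolynomial σ K} (hu : u.totalDegree = 0) (hu0 : u ≠ 0) :
    IsUnit u := by
  rw [totalDegree_eq_zero_iff_eq_C] at hu
  rw [hu]
  refine (IsUnit.map C) (Ne.isUnit ?_)
  intro h0
  apply hu0
  rw [hu, h0, C_0]

/-- A non-zero linear form is prime in the polynomial ring. [folklore] -/
theorem prime_of_isHomogeneous_one {p : MvPolynomial σ K} (hp : p.IsHomogeneous 1) (hp0 : p ≠ 0) :
    Prime p := by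
  have hdeg : p.totalDegree = 1 := hp.totalDegree hp0
  refine UniqueFactorizationMonoid.irreducible_iff_prime.1 ⟨?_, ?_⟩
  · intro hu
    obtain ⟨v, hv⟩ := hu.exists_right_inv
    have hv0 : v ≠ 0 := by
      rintro rfl
      rw [mul_zero] at hv
      exact zero_ne_one hv
    have h := totalDegree_mul_of_isDomain hp0 hv0
    rw [hv, totalDegree_one, hdeg] at h
    omega
  · intro a b hab
    have ha0 : a ≠ 0 := by rintro rfl; rw [zero_mul] at hab; exact hp0 hab
    have hb0 : b ≠ 0 := by rintro rfl; rw [mul_zero] at hab; exact hp0 hab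
    have h := totalDegree_mul_of_isDomain ha0 hb0
    rw [← hab, hdeg] at h
    rcases Nat.eq_zero_or_pos a.totalDegree with ha | ha
    · exact Or.inl (isUnit_of_totalDegree_eq_zero ha ha0)
    · exact Or.inr (isUnit_of_totalDegree_eq_zero (by omega) hb0)

/-- A linear form divisible by a non-zero linear form is a constant multiple of it. [folklore] -/
theorem eq_C_mul_of_dvd {p q : MvPolynomial σ K} (hp : p.IsHomogeneous 1) (hp0 : p ≠ 0)
    (hq : q.IsHomogeneous 1) (hdvd : p ∣ q) : ∃ α : K, q = C α * p := by
  obtain ⟨u, rfl⟩ := hdvd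
  by_cases hu0 : u = 0
  · refine ⟨0, ?_⟩
    rw [hu0, mul_zero, C_0, zero_mul]
  · have hpu : p * u ≠ 0 := mul_ne_zero hp0 hu0
    have h := totalDegree_mul_of_isDomain hp0 hu0
    rw [hq.totalDegree hpu, hp.totalDegree hp0] at h
    have hu : u.totalDegree = 0 := by omega
    rw [totalDegree_eq_zero_iff_eq_C] at hu
    refine ⟨coeff 0 u, ?_⟩
    conv_lhs => rw [hu]
    ring

/-- **Trichotomy for a singular `2 × 2` block of linear forms**: if `pt = qr` then
`q = αp ∧ t = αr`, or `r = βp ∧ t = βq`, or `p = 0 ∧ (q = 0 ∨ r = 0)`. [folklore] -/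
theorem trichotomy {p q r t : MvPolynomial σ K} (hp : p.IsHomogeneous 1) (hq : q.IsHomogeneous 1)
    (hr : r.IsHomogeneous 1) (h : p * t = q * r) :
    (∃ α : K, q = C α * p ∧ t = C α * r) ∨ (∃ β : K, r = C β * p ∧ t = C β * q) ∨
      (p = 0 ∧ (q = 0 ∨ r = 0)) := by
  by_cases hp0 : p = 0
  · refine Or.inr (Or.inr ⟨hp0, ?_⟩)
    rw [hp0, zero_mul] at h
    exact mul_eq_zero.1 h.symm
  · have hprime := prime_of_isHomogeneous_one hp hp0
    have hdvd : p ∣ q * r := ⟨t, h.symm⟩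
    rcases hprime.dvd_or_dvd hdvd with hpq | hpr
    · obtain ⟨α, hα⟩ := eq_C_mul_of_dvd hp hp0 hq hpq
      refine Or.inl ⟨α, hα, ?_⟩
      have h' : p * (t - C α * r) = 0 := by rw [mul_sub, h, hα]; ring
      rcases mul_eq_zero.1 h' with h1 | h1
      · exact absurd h1 hp0
      · exact sub_eq_zero.1 h1
    · obtain ⟨β, hβ⟩ := eq_C_mul_of_dvd hp hp0 hr hpr
      refine Or.inr (Or.inl ⟨β, hβ, ?_⟩)
      have h' : p * (t - C β * q) = 0 := by rw [mul_sub, h, hβ]; ring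
      rcases mul_eq_zero.1 h' with h1 | h1
      · exact absurd h1 hp0
      · exact sub_eq_zero.1 h1

/-- **A singular `2 × 2` block of linear forms has a controlling row or column**: if
`N : Matrix (Fin 2) (Fin 2)` has linear-form entries and `det N = 0`, there are two positions whose
entries' common zeros are common zeros of all entries of `N`. [folklore] -/
theorem exists_two_entries_control (N : Matrix (Fin 2) (Fin 2) (MvPolynomial σ K))
    (hN : ∀ i j, (N i j).IsHomogeneous 1) (hdet : N.det = 0) :
    ∃ e₁ e₂ : Fin 2 × Fin 2, ∀ x : σ → K, eval x (N e₁.1 e₁.2) = 0 → eval x (N e₂.1 e₂.2) = 0 →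
      ∀ i j, eval x (N i j) = 0 := by
  rw [Matrix.det_fin_two, sub_eq_zero] at hdet
  -- `p t = q r` with `p = N₀₀, q = N₀₁, r = N₁₀, t = N₁₁`
  rcases trichotomy (hN 0 0) (hN 0 1) (hN 1 0) hdet with ⟨α, hq, ht⟩ | ⟨β, hr, ht⟩ | ⟨hp, hq | hr⟩
  · -- column `0` controls
    refine ⟨((0 : Fin 2), (0 : Fin 2)), ((1 : Fin 2), (0 : Fin 2)), fun x h1 h2 i j => ?_⟩
    fin_cases i <;> fin_cases j
    · exact h1
    · show eval x (N 0 1) = 0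
      rw [hq, map_mul, eval_C, h1, mul_zero]
    · exact h2
    · show eval x (N 1 1) = 0
      rw [ht, map_mul, eval_C, h2, mul_zero]
  · -- row `0` controls
    refine ⟨((0 : Fin 2), (0 : Fin 2)), ((0 : Fin 2), (1 : Fin 2)), fun x h1 h2 i j => ?_⟩
    fin_cases i <;> fin_cases j
    · exact h1
    · exact h2
    · show eval x (N 1 0) = 0
      rw [hr, map_mul, eval_C, h1, mul_zero]
    · show eval x (N 1 1) = 0
      rw [ht, map_mul, eval_C, h2, mul_zero]
  · -- row `0` is zero: row `1` controls
    refine ⟨((1 : Fin 2), (0 : Fin 2)), ((1 : Fin 2), (1 : Fin 2)), fun x h1 h2 i j => ?_⟩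
    fin_cases i <;> fin_cases j
    · show eval x (N 0 0) = 0
      rw [hp, map_zero]
    · show eval x (N 0 1) = 0
      rw [hq, map_zero]
    · exact h1
    · exact h2
  · -- column `0` is zero: column `1` controls
    refine ⟨((0 : Fin 2), (1 : Fin 2)), ((1 : Fin 2), (1 : Fin 2)), fun x h1 h2 i j => ?_⟩
    fin_cases i <;> fin_cases j
    · show eval x (N 0 0) = 0
      rw [hp, map_zero]
    · exact h1
    · show eval x (N 1 0) = 0
      rw [hr, map_zero]
    · exact h2

end SingularBlock

/-- **Singular `2 × 2` block of linear forms** (registered helper form of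
`SingularBlock.exists_two_entries_control`). [folklore] -/
theorem singularBlock_two_entries_control : ∀ {K : Type*} [Field K] {σ : Type*} (N : Matrix (Fin 2) (Fin 2) (MvPolynomial σ K)), (∀ i j, (N i j).IsHomogeneous 1) → N.det = 0 → ∃ e₁ e₂ : Fin 2 × Fin 2, ∀ x : σ → K, MvPolynomial.eval x (N e₁.1 e₁.2) = 0 → MvPolynomial.eval x (N e₂.1 e₂.2) = 0 → ∀ i j, MvPolynomial.eval x (N i j) = 0 :=
  fun N hN hdet => SingularBlock.exists_two_entries_control N hN hdet

end

end Summit.ValiantsHypothesis.ValiantsHypothesis.Theorems.BorderApolarityToricWitnessObstructionQP
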